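import Summits.Ventures.CertifiedArithmetic.Expansions.Orient2dTailsZeroPin
import Summits.Ventures.CertifiedArithmetic.Expansions.Orient2dEstimateZero
import Literature.ComputerArithmetic.RumpOgitaOishi2008.TransformFinal
import Literature.ComputerArithmetic.BoldoMuller2011.ErrFmaAppr
import Mathlib.Tactic.Linarith
import Mathlib.Tactic.NormNum
import Mathlib.Tactic.Positivity
import Mathlib.Tactic.Ring

/-!
# ORIENT2D, the tails-zero exit: a returned `det = 0` means a zero determinant

NEW WORK in the sense of this development (statement and proof ours; no published counterpart
claimed).  This settles, for same-sign products in the normal range and `p ≥ 4`, the question left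
open in `Orient2dEstimateZero`: at the exit `if ((acxtail == 0.0) && …) return det;` of Shewchuk's
`orient2dadapt` [Shewchuk1997, Fig. 21 / predicates.c], `det = estimate(B) = 0` forces the TRUE
determinant to be `0`.

* `tailsZero_core` — the TWO-TWO-DIFF chain of `(A, a₀) − (B, b₀)` for two error-free products of
  one sign (`A = A ⊕ a₀`, `B = B ⊕ b₀`, `A, B ≥ 2^(emin+2p+2)`): with `i = (−b₀) ⊕ a₀`, `j = i ⊕ A`,
  `z₀` the roundoff of that sum and `i' = (−B) ⊕ z₀`, if `B₀ ⊕ B₁ = −(i' + j)` (what `estimate = 0`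
  gives, `Orient2dEstimateZero.estimate_four_eq_zero`) then `i' + j = 0`.  Proof: the standard-model
  facts make `A`, `B`, `j`, `−i'` comparable (`A + B ≤ 3j`), so `|B₀| < (3/16)·ulp(j)` and
  `|B₁| ≤ |z₀| ≤ ulp(j)/2`, whence `|B₃| < ulp(j)` for `B₃ = i' + j`; the grid-pinning lemma
  `grid_pin_float` then leaves two rigid configurations, `B₃ = −ulp(j)` or `B₃ = ulp(−i')
  = ulp(j)/2`, and in both the float `−B₃·(1 − 2^−p)` lies strictly between `B₀ + B₁` and
  `B₀ ⊕ B₁ = −B₃` — contradicting round-to-nearest.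
* `twoTwoProdDiff_estimate_eq_zero_sum` — block form: error-free two-products of floats, both
  rounded products `≥ 2^(emin+2p+2)`, `RoundoffBelow 2` rounding: `estimate = 0 → x₁x₂ − x₃x₄ = 0`.
* `orient2d_tailsZero_det_eq_zero` — for `orient2dadapt`: the four coordinate differences floats,
  error-free two-products, both rounded products `≥ 2^(emin+2p+2)` (automatic for nonzero products
  of coordinates in `F(p, e₀)` when `emin + 2p + 2 ≤ 2e₀`): `det_B = 0 → t_A = 0`.  (Both products
  negative follows for an odd rounding by exchanging the roles of `a` and `b`; products of opposite
  strict signs never reach this exit — stage A returns; a zero product is outside this statement.)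
-/

namespace Summit.Ventures.CertifiedArithmetic.Expansions

open Literature.ComputerArithmetic.JeannerodRump2018
open Literature.ComputerArithmetic.BoldoJeannerodMelquiondMuller2023 hiding twoSum twoSum_fst
  isFloat_twoSum
open Literature.ComputerArithmetic.Shewchuk1997
open Literature.ComputerArithmetic.RumpOgitaOishi2008 (add_eq_zero_of_fl_add_eq_zero)
open Literature.ComputerArithmetic.BoldoMuller2011 (unitRoundoff_le_sixteenth)

variable {p : ℕ} {emin : ℤ} {fl : ℚ → ℚ}

/-- For floats `a, b`: `|fl (a + b) − (a + b)| ≤ u · |a + b|`. -/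
theorem abs_err_add_le_u (hp : 1 ≤ p) (hfl : IsRoundNearest p emin fl) {a b : ℚ}
    (ha : IsFloat p emin a) (hb : IsFloat p emin b) :
    |fl (a + b) - (a + b)| ≤ unitRoundoff p * |a + b| := by
  have hu0 : 0 < unitRoundoff p := by unfold unitRoundoff; positivity
  have h := abs_err_add_le_sharp hp hfl ha hb
  have hle : unitRoundoff p / (1 + unitRoundoff p) ≤ unitRoundoff p :=
    div_le_self hu0.le (by linarith)
  exact h.trans (mul_le_mul_of_nonneg_right hle (abs_nonneg _))

/-- `u · t < ulp(t)` for `t > 0`. -/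
theorem u_mul_lt_ulp {t : ℚ} (ht : 0 < t) : unitRoundoff p * t < ulp p emin t := by
  have h := abs_lt_two_pow_mul_ulp (p := p) (emin := emin) t
  rw [abs_of_pos ht] at h
  unfold unitRoundoff
  rw [one_div, inv_mul_eq_div, div_lt_iff₀ (by positivity)]
  linarith

/-- **THE CORE.** See the module docstring. -/
theorem tailsZero_core (hp : 4 ≤ p) (hfl : IsRoundNearest p emin fl)
    {A a₀ B b₀ i j i' : ℚ} (hFA : IsFloat p emin A) (hFa : IsFloat p emin a₀)
    (hFB : IsFloat p emin B) (hFb : IsFloat p emin b₀)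
    (hAe : fl (A + a₀) = A) (hBe : fl (B + b₀) = B)
    (hAr : (2 : ℚ) ^ (emin + 2 * p + 2) ≤ A) (hBr : (2 : ℚ) ^ (emin + 2 * p + 2) ≤ B)
    (hi : fl (-b₀ + a₀) = i) (hj : fl (i + A) = j) (hi' : fl (-B + (i + A - j)) = i')
    (hQ : fl ((-b₀ + a₀ - i) + (-B + (i + A - j) - i')) = -(i' + j)) :
    i' + j = 0 := by
  by_contra hne
  have hp1 : 1 ≤ p := (by omega); have hp2 : 2 ≤ p := by omega
  set u := unitRoundoff p with hu
  have hu0 : 0 < u := by rw [hu]; unfold unitRoundoff; positivity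
  have hu16 : u ≤ 1 / 16 := unitRoundoff_le_sixteenth hp
  have h2 : (0 : ℚ) < 2 := by norm_num
  -- the small quantities
  set B₀ := -b₀ + a₀ - i with hB₀
  set z₀ := i + A - j with hz₀
  set B₁ := -B + z₀ - i' with hB₁
  set w := B₀ + B₁ with hw
  -- floats
  have hFi : IsFloat p emin i := hi ▸ (hfl _).1; have hFj : IsFloat p emin j := hj ▸ (hfl _).1
  have hFi' : IsFloat p emin i' := hi' ▸ (hfl _).1
  have hFB₀ : IsFloat p emin B₀ := by
    have h := (twoSum_exact hp1 hfl hFb.neg hFa).1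
    have hF := (isFloat_twoSum hfl (-b₀) a₀).2
    rw [h, hi] at hF
    exact hF
  have hFz : IsFloat p emin z₀ := by
    have h := (twoSum_exact hp1 hfl hFi hFA).1
    have hF := (isFloat_twoSum hfl i A).2
    rw [h, hj] at hF
    exact hF
  have hFB₁ : IsFloat p emin B₁ := by
    have h := (twoSum_exact hp1 hfl hFB.neg hFz).1
    have hF := (isFloat_twoSum hfl (-B) z₀).2
    rw [h, hi'] at hF
    exact hF
  -- positivity of A, B and the range facts
  have hApos : 0 < A := (zpow_pos h2 _).trans_le hAr
  have hBpos : 0 < B := (zpow_pos h2 _).trans_le hBr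
  -- standard-model facts
  have ha₀ : |a₀| ≤ u * A := by
    have h := abs_err_add_le_sharp hp1 hfl hFA hFa
    rw [hAe, show A - (A + a₀) = -a₀ by ring, abs_neg, div_mul_eq_mul_div,
      le_div_iff₀ (by linarith)] at h
    have hA' : |A + a₀| ≤ A + |a₀| := by
      calc |A + a₀| ≤ |A| + |a₀| := abs_add_le _ _
        _ = A + |a₀| := by rw [abs_of_pos hApos]
    linarith [mul_le_mul_of_nonneg_left hA' hu0.le, abs_nonneg a₀]
  have hb₀ : |b₀| ≤ u * B := by
    have h := abs_err_add_le_sharp hp1 hfl hFB hFb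
    rw [hBe, show B - (B + b₀) = -b₀ by ring, abs_neg, div_mul_eq_mul_div,
      le_div_iff₀ (by linarith)] at h
    have hB' : |B + b₀| ≤ B + |b₀| := by
      calc |B + b₀| ≤ |B| + |b₀| := abs_add_le _ _
        _ = B + |b₀| := by rw [abs_of_pos hBpos]
    linarith [mul_le_mul_of_nonneg_left hB' hu0.le, abs_nonneg b₀]
  have hB₀u : |B₀| ≤ u * (|a₀| + |b₀|) := by
    have h := abs_err_add_le_u hp1 hfl hFb.neg hFa
    rw [hi, abs_sub_comm] at h
    have h' : |(-b₀) + a₀| ≤ |a₀| + |b₀| := by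
      calc |(-b₀) + a₀| ≤ |-b₀| + |a₀| := abs_add_le _ _
        _ = |a₀| + |b₀| := by rw [abs_neg, add_comm]
    exact h.trans (mul_le_mul_of_nonneg_left h' hu0.le)
  have hz₀u : |z₀| ≤ u * (|i| + A) := by
    have h := abs_err_add_le_u hp1 hfl hFi hFA
    rw [hj, abs_sub_comm] at h
    have h' : |i + A| ≤ |i| + A := by
      calc |i + A| ≤ |i| + |A| := abs_add_le _ _
        _ = |i| + A := by rw [abs_of_pos hApos]
    exact h.trans (mul_le_mul_of_nonneg_left h' hu0.le)
  have hz₀j : |z₀| ≤ ulp p emin j / 2 := by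
    have h := abs_sub_fl_le_half_ulp_fl hp1 hfl (i + A)
    rwa [hj] at h
  have hB₁z : |B₁| ≤ |z₀| := by
    have h := abs_err_le_abs_operand hfl hFB.neg z₀
    rwa [hi', abs_sub_comm] at h
  have hB₁i' : |B₁| ≤ ulp p emin i' / 2 := by
    have h := abs_sub_fl_le_half_ulp_fl hp1 hfl (-B + z₀)
    rwa [hi'] at h
  have hB₃ : |i' + j| ≤ (1 + u) * (|B₀| + |B₁|) := by
    have h := abs_err_add_le_u hp1 hfl hFB₀ hFB₁
    rw [hQ] at h
    have hw' : |B₀ + B₁| ≤ |B₀| + |B₁| := abs_add_le _ _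
    have h1 : |-(i' + j) - (B₀ + B₁)| ≥ |i' + j| - |B₀ + B₁| := by
      have := abs_sub_abs_le_abs_sub (-(i' + j)) (B₀ + B₁)
      rw [abs_neg] at this
      linarith
    linarith [mul_le_mul_of_nonneg_left hw' hu0.le, abs_nonneg (B₀ + B₁)]
  have hi_le : |i| ≤ |a₀| + |b₀| + |B₀| := by
    have : i = a₀ + (-b₀) + (-B₀) := by rw [hB₀]; ring
    rw [this]
    calc |a₀ + -b₀ + -B₀| ≤ |a₀ + -b₀| + |-B₀| := abs_add_le _ _
      _ ≤ |a₀| + |-b₀| + |-B₀| := by linarith [abs_add_le a₀ (-b₀)]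
      _ = |a₀| + |b₀| + |B₀| := by rw [abs_neg, abs_neg]
  -- numeric versions (u ≤ 1/16)
  have ha₀' : |a₀| ≤ A / 16 := by
    linarith [mul_le_mul_of_nonneg_right hu16 hApos.le]
  have hb₀' : |b₀| ≤ B / 16 := by
    linarith [mul_le_mul_of_nonneg_right hu16 hBpos.le]
  have hB₀' : |B₀| ≤ (|a₀| + |b₀|) / 16 := by
    linarith [mul_le_mul_of_nonneg_right hu16 (by positivity : (0 : ℚ) ≤ |a₀| + |b₀|)]
  have hz₀' : |z₀| ≤ (|i| + A) / 16 := by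
    linarith [mul_le_mul_of_nonneg_right hu16 (by positivity : (0 : ℚ) ≤ |i| + A)]
  have hB₃' : |i' + j| ≤ 17 / 16 * (|B₀| + |B₁|) := by
    linarith [mul_le_mul_of_nonneg_right (by linarith : 1 + u ≤ 17 / 16)
      (by positivity : (0 : ℚ) ≤ |B₀| + |B₁|)]
  -- two-sided forms for linarith
  have ea₀ := abs_le.mp (le_refl |a₀|); have eb₀ := abs_le.mp (le_refl |b₀|)
  have eB₀ := abs_le.mp (le_refl |B₀|); have ez₀ := abs_le.mp (le_refl |z₀|)
  have eB₁ := abs_le.mp (le_refl |B₁|); have eB₃ := abs_le.mp (le_refl |i' + j|)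
  have hidef : i = -b₀ + a₀ - B₀ := by rw [hB₀]; ring
  have hjdef : j = i + A - z₀ := by rw [hz₀]; ring
  have hi'def : i' = -B + z₀ - B₁ := by rw [hB₁]; ring
  -- S1: everything is comparable
  have hS1 : A + B ≤ 3 * j := by
    linarith [abs_nonneg a₀, abs_nonneg b₀, abs_nonneg B₀, abs_nonneg z₀, abs_nonneg B₁]
  have hjA : A ≤ 2 * j := by
    linarith [abs_nonneg a₀, abs_nonneg b₀, abs_nonneg B₀, abs_nonneg z₀, abs_nonneg B₁]
  have hyB : B ≤ 2 * (-i') := by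
    linarith [abs_nonneg a₀, abs_nonneg b₀, abs_nonneg B₀, abs_nonneg z₀, abs_nonneg B₁]
  have hj0 : 0 < j := by linarith
  set y := -i' with hy; have hy0 : 0 < y := by linarith
  have hFy : IsFloat p emin y := hFi'.neg
  -- normality of j and y, and the exponent room below ulp(j)
  have hpow1 : (2 : ℚ) ^ (emin + p - 1) ≤ 2 ^ (emin + 2 * p + 2) / 2 := by
    rw [le_div_iff₀ h2, ← zpow_add_one₀ (ne_of_gt h2)]
    exact zpow_le_zpow_right₀ (by norm_num) (by omega)
  have hjn : (2 : ℚ) ^ (emin + p - 1) ≤ j := by linarith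
  have hyn : (2 : ℚ) ^ (emin + p - 1) ≤ y := by linarith
  have hulpj : u * j < ulp p emin j := u_mul_lt_ulp hj0
  have hulpj_big : (2 : ℚ) ^ (emin + p + 1) < ulp p emin j := by
    have h1 : (2 : ℚ) ^ (emin + p + 1) ≤ u * j := by
      have : (2 : ℚ) ^ (emin + p + 1) = u * (2 ^ (emin + 2 * p + 2) / 2) := by
        have hu' : u = (2 : ℚ) ^ (-(p : ℤ)) := by
          rw [hu]; unfold unitRoundoff; rw [zpow_neg, zpow_natCast, one_div]
        have h22 : (2 : ℚ) ^ (emin + 2 * p + 2) / 2 = 2 ^ (emin + 2 * p + 1) := by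
          rw [div_eq_iff (ne_of_gt h2), ← zpow_add_one₀ (ne_of_gt h2)]; congr 1; ring
        rw [hu', h22, ← zpow_add₀ (ne_of_gt h2)]; congr 1; ring
      rw [this]
      exact mul_le_mul_of_nonneg_left (by linarith) hu0.le
    linarith
  -- |B₀| < (3/16)·ulp(j), hence |B₃| < ulp(j)
  have hB₀j : |B₀| < 3 / 16 * ulp p emin j := by
    have h1 : |B₀| ≤ u * ((A + B) / 16) := by
      calc |B₀| ≤ u * (|a₀| + |b₀|) := hB₀u
        _ ≤ u * ((A + B) / 16) := mul_le_mul_of_nonneg_left (by linarith) hu0.le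
    have h2' : u * (A + B) ≤ u * (3 * j) := mul_le_mul_of_nonneg_left hS1 hu0.le
    linarith
  have hU0 : 0 < ulp p emin j := ulp_pos (p := p) (emin := emin) j
  have hB₃lt : |j - y| < ulp p emin j := by
    rw [hy, sub_neg_eq_add, add_comm]
    linarith [hB₁z.trans hz₀j, abs_nonneg B₀, abs_nonneg B₁]
  have hne' : j ≠ y := by
    intro h; apply hne; rw [hy] at h; linarith
  -- grid pinning: two rigid configurations
  have key : (i' + j = -ulp p emin j ∧ ∃ a : ℤ, ulp p emin j = (2 : ℚ) ^ a) ∨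
      (i' + j = ulp p emin y ∧ ulp p emin j = 2 * ulp p emin y ∧
        ∃ b : ℤ, ulp p emin y = (2 : ℚ) ^ b) := by
    rcases lt_or_ge (ulp p emin j) (ulp p emin y) with hjy | hyj
    · left
      obtain ⟨-, -, hd⟩ := grid_pin_float hp2 hFj hFy hj0 hy0 hjn hyn hne' (hB₃lt.trans hjy)
      obtain ⟨a, -, ha⟩ := exists_ulp_eq_two_zpow (p := p) (emin := emin) j
      refine ⟨?_, a, ha⟩
      rw [hy] at hd; linarith
    · right
      have hlt' : |y - j| < ulp p emin j := by rwa [abs_sub_comm]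
      obtain ⟨hU, -, hd⟩ := grid_pin_float hp2 hFy hFj hy0 hj0 hyn hjn hne'.symm hlt'
      obtain ⟨b, -, hb⟩ := exists_ulp_eq_two_zpow (p := p) (emin := emin) y
      refine ⟨?_, hU, b, hb⟩
      rw [hy] at hd; linarith
  -- the common contradiction: a float strictly between `w = B₀ + B₁` and `fl w = −B₃`
  have hmin : ∀ f : ℚ, IsFloat p emin f → |w - -(i' + j)| ≤ |w - f| := by
    intro f hf
    have h := abs_sub_fl_le hfl w hf
    rwa [hQ] at h
  have hw_le : |w| ≤ |B₀| + |B₁| := abs_add_le _ _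
  rcases key with ⟨hB3, a, ha⟩ | ⟨hB3, hU, b, hb⟩
  · -- B₃ = −V, V = ulp j = 2^a; candidate f = V − 2^(a−p) = (2^p − 1)·2^(a−p)
    have hVbig : (2 : ℚ) ^ (emin + p + 1) < 2 ^ a := ha ▸ hulpj_big
    have hap : emin ≤ a - p := by
      have := (zpow_lt_zpow_iff_right₀ (by norm_num : (1 : ℚ) < 2)).mp hVbig
      omega
    have hf : IsFloat p emin (((2 ^ p - 1 : ℤ) : ℚ) * 2 ^ (a - p)) := by
      refine isFloat_of_int_mul _ _ ?_ hap
      rw [abs_of_nonneg (by have := one_le_pow₀ (M₀ := ℤ) (a := 2) (n := p) (by norm_num); omega)]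
      omega
    have hfval : ((2 ^ p - 1 : ℤ) : ℚ) * 2 ^ (a - p) = 2 ^ a - u * 2 ^ a := by
      rw [hu]; unfold unitRoundoff
      rw [zpow_sub₀ (ne_of_gt h2), zpow_natCast]; push_cast
      field_simp
    have h := hmin _ hf
    rw [hfval, hB3, neg_neg, ha] at h
    -- |w| < (11/16) V and u V ≤ V/16
    have hV0 : (0 : ℚ) < 2 ^ a := zpow_pos h2 a
    have hwV : |w| < 11 / 16 * 2 ^ a := by
      have : |B₁| ≤ 2 ^ a / 2 := by rw [← ha]; exact hB₁z.trans hz₀j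
      rw [ha] at hB₀j; linarith
    have huV : u * 2 ^ a ≤ 1 / 16 * 2 ^ a := mul_le_mul_of_nonneg_right hu16 hV0.le
    have huV0 : 0 < u * 2 ^ a := mul_pos hu0 hV0
    have ew := abs_le.mp (le_refl |w|)
    rw [abs_of_nonpos (by linarith : w - 2 ^ a ≤ 0),
      abs_of_nonpos (by linarith : w - (2 ^ a - u * 2 ^ a) ≤ 0)] at h
    linarith
  · -- B₃ = W = ulp y = 2^b, ulp j = 2W; candidate f = −(W − 2^(b−p))
    have hWbig : (2 : ℚ) ^ (emin + p + 1) < 2 * 2 ^ b := by rw [← hb, ← hU]; exact hulpj_big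
    have hbp : emin ≤ b - p := by
      have h1 : (2 : ℚ) ^ (emin + p + 1) < 2 ^ (b + 1) := by
        have : (2 : ℚ) ^ (b + 1) = 2 * 2 ^ b := by rw [zpow_add_one₀ (ne_of_gt h2), mul_comm]
        rw [this]; exact hWbig
      have := (zpow_lt_zpow_iff_right₀ (by norm_num : (1 : ℚ) < 2)).mp h1
      omega
    have hf : IsFloat p emin (((-(2 ^ p - 1) : ℤ) : ℚ) * 2 ^ (b - p)) := by
      refine isFloat_of_int_mul _ _ ?_ hbp
      rw [abs_neg,
        abs_of_nonneg (by have := one_le_pow₀ (M₀ := ℤ) (a := 2) (n := p) (by norm_num); omega)]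
      omega
    have hfval : ((-(2 ^ p - 1) : ℤ) : ℚ) * 2 ^ (b - p) = -(2 ^ b - u * 2 ^ b) := by
      rw [hu]; unfold unitRoundoff
      rw [zpow_sub₀ (ne_of_gt h2), zpow_natCast]; push_cast
      field_simp
    have h := hmin _ hf
    rw [hfval, hB3, hb] at h
    have hW0 : (0 : ℚ) < 2 ^ b := zpow_pos h2 b
    have hwW : |w| < 7 / 8 * 2 ^ b := by
      have h1 : |B₁| ≤ 2 ^ b / 2 := by
        have : ulp p emin i' = ulp p emin y := by rw [hy, ulp_neg]
        rw [← hb, ← this]; exact hB₁i'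
      rw [hU, hb] at hB₀j; linarith
    have huW : u * 2 ^ b ≤ 1 / 16 * 2 ^ b := mul_le_mul_of_nonneg_right hu16 hW0.le
    have huW0 : 0 < u * 2 ^ b := mul_pos hu0 hW0
    have ew := abs_le.mp (le_refl |w|)
    rw [abs_of_nonneg (by linarith : 0 ≤ w - -(2 ^ b)),
      abs_of_nonneg (by linarith : 0 ≤ w - -(2 ^ b - u * 2 ^ b))] at h
    linarith

/-- **BLOCK FORM.** Error-free two-products of floats, both rounded products at least
`2^(emin+2p+2)`, `estimate` of the (nonoverlapping) TWO-TWO-DIFF block equal to `0` ⟹ the exact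
difference of the products is `0` (`p ≥ 4`, round-to-nearest with `RoundoffBelow 2`). -/
theorem twoTwoProdDiff_estimate_eq_zero_sum (hp : 4 ≤ p) (hfl : IsRoundNearest p emin fl)
    (hfl2 : RoundoffBelow 2 fl) {tp : ℚ → ℚ → ℚ × ℚ} {x₁ x₂ x₃ x₄ : ℚ}
    (h₁₂ : ExactTwoProd p emin fl tp x₁ x₂) (h₃₄ : ExactTwoProd p emin fl tp x₃ x₄)
    (hA : (2 : ℚ) ^ (emin + 2 * p + 2) ≤ fl (x₁ * x₂))
    (hB : (2 : ℚ) ^ (emin + 2 * p + 2) ≤ fl (x₃ * x₄))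
    (hz : estimate fl (twoTwoProdDiff tp fl x₁ x₂ x₃ x₄) = 0) : x₁ * x₂ - x₃ * x₄ = 0 := by
  have hp1 : 1 ≤ p := (by omega); have hp2 : 2 ≤ p := by omega
  obtain ⟨hW, hS, -, -⟩ := twoTwoProdDiff_spec hp1 hfl hfl2 h₁₂ h₃₄
  rw [← hS]
  obtain ⟨hA1, hAs, hFa⟩ := h₁₂
  obtain ⟨hB1, hBs, hFb⟩ := h₃₄
  unfold twoTwoProdDiff at hW hz ⊢
  obtain ⟨B₀, B₁, B₃, hBlk, hQ, hF₀, hF₁, -, -⟩ :=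
    twoTwoDiff_estimate_eq_zero hp2 hfl hW.isExpansion hz
  rw [hBlk]
  simp only [List.sum_cons, List.sum_nil, add_zero]
  set A := (tp x₁ x₂).1 with hAdef
  set a₀ := (tp x₁ x₂).2 with ha₀def
  set B := (tp x₃ x₄).1 with hBdef
  set b₀ := (tp x₃ x₄).2 with hb₀def
  have hFA : IsFloat p emin A := by rw [hA1]; exact (hfl _).1
  have hFB : IsFloat p emin B := by rw [hB1]; exact (hfl _).1
  have hAe : fl (A + a₀) = A := by rw [hAs, ← hA1]
  have hBe : fl (B + b₀) = B := by rw [hBs, ← hB1]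
  rw [← hA1] at hA
  rw [← hB1] at hB
  -- the chain
  rw [twoTwoDiff_eq] at hBlk
  simp only [List.cons.injEq, and_true] at hBlk
  obtain ⟨e1, e2, e3, e4⟩ := hBlk
  set i := (twoSum fl (-b₀) a₀).1 with hidef
  set j := (twoSum fl i A).1 with hjdef
  have hFi : IsFloat p emin i := (isFloat_twoSum hfl (-b₀) a₀).1
  have hz₀ : (twoSum fl i A).2 = i + A - j := by
    rw [(twoSum_exact hp1 hfl hFi hFA).1, hjdef, twoSum_fst]
  rw [hz₀] at e2 e3 e4
  set i' := (twoSum fl (-B) (i + A - j)).1 with hi'def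
  have hFi' : IsFloat p emin i' := (isFloat_twoSum hfl (-B) (i + A - j)).1
  have hFj : IsFloat p emin j := (isFloat_twoSum hfl i A).1
  have hFz : IsFloat p emin (i + A - j) := hz₀ ▸ (isFloat_twoSum hfl i A).2
  -- B₃ = i' + j (the top TWO-SUM is exact since its roundoff B₂ is 0)
  have hB₃ : B₃ = i' + j := by
    have h := (twoSum_exact hp1 hfl hFi' hFj).2
    rw [e3, e4, add_zero] at h
    exact h
  have hB₀ : B₀ = -b₀ + a₀ - i := by
    rw [← e1, (twoSum_exact hp1 hfl hFb.neg hFa).1, hidef, twoSum_fst]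
  have hB₁ : B₁ = -B + (i + A - j) - i' := by
    rw [← e2, (twoSum_exact hp1 hfl hFB.neg hFz).1, hi'def, twoSum_fst]
  have hcore : i' + j = 0 := by
    refine tailsZero_core (i := i) (j := j) (i' := i') hp hfl hFA hFa hFB hFb hAe hBe hA hB
      (by rw [hidef, twoSum_fst]) (by rw [hjdef, twoSum_fst]) (by rw [hi'def, twoSum_fst]) ?_
    rw [← hB₀, ← hB₁, hQ, hB₃]
  have hB₃0 : B₃ = 0 := by rw [hB₃, hcore]
  rw [hB₃0, neg_zero] at hQ
  have := add_eq_zero_of_fl_add_eq_zero hp1 hfl hF₀ hF₁ hQ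
  linarith

/-- **ORIENT2D, THE TAILS-ZERO EXIT.** If the four coordinate differences are floats (so
`orient2dadapt` returns `det = estimate(4, B)` right after stage B), the two-products are
error-free, both rounded products are at least `2^(emin+2p+2)`, and the returned `det` is `0`, then
the TRUE determinant is `0` (`p ≥ 4`, round-to-nearest with `RoundoffBelow 2`). -/
theorem orient2d_tailsZero_det_eq_zero (hp : 4 ≤ p) (hfl : IsRoundNearest p emin fl)
    (hfl2 : RoundoffBelow 2 fl) {tp : ℚ → ℚ → ℚ × ℚ} {a₁ a₂ b₁ b₂ c₁ c₂ : ℚ}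
    (h₁ : IsFloat p emin (a₁ - c₁)) (h₂ : IsFloat p emin (b₂ - c₂)) (h₃ : IsFloat p emin (a₂ - c₂))
    (h₄ : IsFloat p emin (b₁ - c₁)) (h₁₂ : ExactTwoProd p emin fl tp (a₁ - c₁) (b₂ - c₂))
    (h₃₄ : ExactTwoProd p emin fl tp (a₂ - c₂) (b₁ - c₁))
    (hA : (2 : ℚ) ^ (emin + 2 * p + 2) ≤ fl ((a₁ - c₁) * (b₂ - c₂)))
    (hB : (2 : ℚ) ^ (emin + 2 * p + 2) ≤ fl ((a₂ - c₂) * (b₁ - c₁)))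
    (hz : orient2dDetB tp fl a₁ a₂ b₁ b₂ c₁ c₂ = 0) :
    (a₁ - c₁) * (b₂ - c₂) - (a₂ - c₂) * (b₁ - c₁) = 0 := by
  unfold orient2dDetB at hz
  rw [fl_eq_self hfl h₁, fl_eq_self hfl h₂, fl_eq_self hfl h₃, fl_eq_self hfl h₄] at hz
  exact twoTwoProdDiff_estimate_eq_zero_sum hp hfl hfl2 h₁₂ h₃₄ hA hB hz

end Summit.Ventures.CertifiedArithmetic.Expansions
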